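import Literature.MathematicalPhysics.QuantumFieldTheory.ConformalBootstrap3D.PointKernelK57Data
import Literature.MathematicalPhysics.QuantumFieldTheory.ConformalBootstrap3D.PointKernelParts

/-!
# K57 certificate, kernel part file P20: one-cell head segments 184, 187, 188 in level ranges

The head cells whose kernel evaluation exceeds one `decide` are one-cell segments of `hsegsK57`; each is
checked by `PCert.hPartSideOK` (side conditions) and `PCert.hPartOK` per level range `[n_lo, n_lo + count)`
against an integer claim, the claims summing to `≥ 0` (`PointKernel.partsOK`); soundness is
`PCert.hParts_sound` (`PointKernelParts`).  The part files `P1, P2, …` are mutually independent (each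
imports only the data file); the ranges of one cell may span several of them, and the per-cell
conclusions `hparts_i` / `hcell_i` of those cells are assembled in `PointKernelK57.lean`.
Estimated kernel time 202 s.
-/

set_option maxRecDepth 100000
set_option maxHeartbeats 0

namespace Literature.MathematicalPhysics.QuantumFieldTheory.ConformalBootstrap3D.PointKernelK57

open Literature.MathematicalPhysics.QuantumFieldTheory.ConformalBootstrap3D.PointKernel

/-- levels `[0, 27)` of segment 184: partial lower sum `≥` claim. [folklore] -/
theorem part_184_0 : certK57.hPartOK (PCert.segAt hsegsK57 184) JHK57 0 27 (-17173992070152264606724706989283111657) = true := by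
  decide +kernel

/-- levels `[27, 31)` of segment 184: partial lower sum `≥` claim. [folklore] -/
theorem part_184_1 : certK57.hPartOK (PCert.segAt hsegsK57 184) JHK57 27 4 (17173992070152264606724706989283111657) = true := by
  decide +kernel

/-- one-cell segment 187 (row 8, cell `[289/32, 145/16]`, chord, `n_F = 38`,
3 level ranges): side conditions. [folklore] -/
theorem pside_187 : certK57.hPartSideOK (PCert.segAt hsegsK57 187) JHK57 = true := by
  decide +kernel

/-- its level ranges `(n_lo, count, claim)`. [folklore] -/
def parts_187 : List (ℕ × ℕ × ℤ) := [(0, 26, -28532864142730327141117699776300730144), (26, 12, 29368113373165704741140529458086456417), (38, 1, -835249230435377600022829681785726271)]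

/-- the ranges tile `[0, n_F]` and the claims sum to `≥ 0`. [folklore] -/
theorem pcov_187 : PointKernel.partsOK 38 parts_187 = true := by
  decide +kernel

/-- levels `[0, 26)` of segment 187: partial lower sum `≥` claim. [folklore] -/
theorem part_187_0 : certK57.hPartOK (PCert.segAt hsegsK57 187) JHK57 0 26 (-28532864142730327141117699776300730144) = true := by
  decide +kernel

/-- levels `[26, 38)` of segment 187: partial lower sum `≥` claim. [folklore] -/
theorem part_187_1 : certK57.hPartOK (PCert.segAt hsegsK57 187) JHK57 26 12 (29368113373165704741140529458086456417) = true := by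
  decide +kernel

/-- levels `[38, 39)` of segment 187: partial lower sum `≥` claim. [folklore] -/
theorem part_187_2 : certK57.hPartOK (PCert.segAt hsegsK57 187) JHK57 38 1 (-835249230435377600022829681785726271) = true := by
  decide +kernel

/-- one-cell segment 188 (row 8, cell `[145/16, 291/32]`, chord, `n_F = 30`,
2 level ranges): side conditions. [folklore] -/
theorem pside_188 : certK57.hPartSideOK (PCert.segAt hsegsK57 188) JHK57 = true := by
  decide +kernel

/-- its level ranges `(n_lo, count, claim)`. [folklore] -/
def parts_188 : List (ℕ × ℕ × ℤ) := [(0, 27, -10871136021403944432778199344273735862), (27, 4, 10871136021403944432778199344273735862)]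

/-- the ranges tile `[0, n_F]` and the claims sum to `≥ 0`. [folklore] -/
theorem pcov_188 : PointKernel.partsOK 30 parts_188 = true := by
  decide +kernel

end Literature.MathematicalPhysics.QuantumFieldTheory.ConformalBootstrap3D.PointKernelK57
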